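/-
Copyright (c) 2026 the pub-hodgecm-mathlib formalisation cell (harness21).  Prover seat hodgecm-mathlib-K2E3-p04 (g2), Track B ∕ K2-LIT
(build stream 29), h413 = `stmt-HodgeConjecture-24833`, line `K2_E3_EllipticInputs`, unit U4 «Keys» — road I, brick I-3i «MACDONALD IN THE ORGAN'S CURRENCY (ONE-STOP FORM)».  2026-09-04.
-/
import Summits.HodgeConjecture.HodgeConjecture.Theorems.K2E3SphericalCFunctionMacdonald              -- ★ p856339 (this base, g2): Macdonald at inert ∕ tame-ramified `v ∤ 2`
import Summits.HodgeConjecture.HodgeConjecture.Theorems.K2E3SphericalCFunctionUnramifiedHypotheses   -- ★ p856288 (this base, g2): (H1)(H2)(H3) from «χ trivial on T ∩ K_v» + «contracting»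
import HarnessLib

/-!
# h413 ∕ Track B «K2-LIT», unit U4 «Keys», road I brick I-3i: HARISH-CHANDRA'S `c`-FUNCTION OF `U(Φ₃)(L⁺_v)` IN THE ORGAN'S CURRENCY — for a `K_v`-SPHERICAL CONTRACTING `i_G(χ₁, χ₂)`
# at an inert `v ∤ 2`: the spherical vectors `f_K`, `f'_K` EXIST and `J(w, χ) f_K = μ(N(𝒪_v))·(1 + z∕q_F)(1 − z∕q_F²)∕(1 − z²) · f'_K`   [Rogawski1990 §4.5; Casselman1995 §6.4; Keys1984 §4, §7]

Cell `pub/hodgecm-mathlib`, crux H413 = `stmt-HodgeConjecture-24833` (lane `--supports … --as helper`), route HCCMUnconditional; dealer K2E3-plan (g2) («your call inside Road I»).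
THEOREMS ONLY (0 def ∕ 0 instance ∕ 0 notation ∕ 0 sorry); ★-only imports.  One-stop packaging of road I for an assembly seat: the hypotheses are exactly the organ's — `v` non-split
and inert with `v ∤ 2`, `χ₁, χ₂` continuous, `χ = cmTorusCharPair χ₁ χ₂` TRIVIAL ON `T ∩ K_v` (the spherical hypothesis of ★ `exists_sphericalVector`) and CONTRACTING
(`‖x‖ < 1 ⇒ |χ₁ x| < 1`, U4-f's «Re s > 0»); everything else (`χ₁ = 1` on `𝒪_vˣ`, `χ₂ = 1`, `|χ₁| = ‖·‖^s` with `s > 0`, the spherical vectors) is DERIVED (★ p856288, ★ p855557 §2).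
* §1 `apply_normOneUnits_eq_one_of_trivial` — an unramified `χ` has `χ₂ = 1` on ALL of `E¹_v` (`ι(1, ζ) ∈ K_v` for every `ζ`), hence `wχ = (χ̄₁⁻¹, χ₂)` is unramified too
  (`trivial_weyl_of_trivial`: `χ̄₁⁻¹(α) = χ₁(σα)⁻¹ = 1` for `α ∈ 𝒪_vˣ`, ★ `apply_unitsMap_conjLocal`).
* §2 **`exists_intertwiningIntegral_sphericalVector_eq_macdonald_smul_of_trivial`** — for spherical `f_K ∈ i(χ)^{K_v}`, `f'_K ∈ i(wχ)^{K_v}` (`f'_K(1) = 1`; both exist by ★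
  `exists_sphericalVector` with `hχK` ∕ §1): ∃ `J : i(χ) → i(wχ)`, `J ≠ 0`, `(J f)(g) = ∫_N f(w₀ n g) dμ`, **`J f_K = (μ(B₁)·(1 + z∕q_F)(1 − z∕q_F²)(1 − z²)⁻¹·f_K(1)) • f'_K`**
  (`z = χ₁(ϖ)`, `B₁ = N(𝒪_v)`), with NO hypothesis beyond the organ's «trivial on `T ∩ K_v`» and «contracting».

HONEST LABEL.  HC_CM is proved only modulo the 7 printed citations (2 remaining named inputs: hLiu418 = `stmt-HodgeConjecture-24832`, h413 = `stmt-HodgeConjecture-24833`) until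
rung 0 closes; count-neutral (U4-f is not closed: see ★ `K2E3SphericalReducibilityJunction` for what remains on the unramified line).

## References
* [Rogawski1990] J. D. Rogawski, *Automorphic Representations of Unitary Groups in Three Variables* (1990), §4.5 p. 45, §12.2 p. 173.
* [Casselman1995] W. Casselman, *Introduction to the theory of admissible representations of `p`-adic reductive groups* (1995), §6.4 pp. 62–64.
* [Keys1984] D. Keys, *Principal series representations of special unitary groups over local fields*, Compositio Math. 51 (1984), §4, §7 Thm (2).
* [CartierCorvallis1979] P. Cartier, *Representations of `p`-adic groups: a survey*, Proc. Symp. Pure Math. 33 (1979), §IV.1.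
-/

set_option autoImplicit false
-- the mandated namespace repeats the single-problem summit's segment (`HodgeConjecture.HodgeConjecture`)
set_option linter.dupNamespace false

noncomputable section

open NumberField IsDedekindDomain MeasureTheory
open scoped Matrix NNReal ENNReal

open Literature.NumberTheory Literature.NumberTheory.Automorphic Literature.NumberTheory.Automorphic.UnitaryGroup
open Literature.NumberTheory.GaloisRepresentations Literature.NumberTheory.GaloisRepresentations.IsNonarchimedeanLocalField

namespace Summit.HodgeConjecture.HodgeConjecture.Cruxes.H413.K2E3SphericalCFunctionOrganCurrency

variable (L : Type) [Field L] [NumberField L] [IsCMField L] (v : HeightOneSpectrum (𝓞 ↥(maximalRealSubfield L)))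
  (hns : ∀ w : PlacesOver L v, IsCMField.complexConj L • w.1 = w.1)

/-! ## §1 An unramified `χ` has `χ₂ = 1`, and `wχ` is unramified -/

set_option synthInstance.maxHeartbeats 400000 in
set_option maxHeartbeats 3200000 in
-- the torus chart on the matrix carrier (class of ★ `K2E3SphericalCFunctionUnramifiedHypotheses.apply_neg_one_eq_one_of_trivial`)
include hns in
/-- **An unramified `χ = (χ₁, χ₂)` has `χ₂ = 1` on all of `E¹_v`**: `ι(1, ζ) = d(1, ζ, 1) ∈ K_v` for every `ζ ∈ E¹_v` (★ `torusChart_mem_cmLocalIntegralLevel_iff`), and `χ(ι(1, ζ)) = χ₂(ζ)`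
(★ `cmTorusCharPair_torusChart`). `v` non-split. [cite: Rogawski1990, §12.1 p. 171; §12.2 p. 173] -/
theorem apply_normOneUnits_eq_one_of_trivial (χ₁ : (LocalRing L v)ˣ →* ℂˣ) (χ₂ : ↥(normOneUnits (conjLocal L (IsCMField.complexConj L) v)) →* ℂˣ)
    (hχK : ∀ t : ↥(torusU (conjLocal L (IsCMField.complexConj L) v) (cmLocalForm L 3 v)), (t : ↥(unitaryGroupOfForm (conjLocal L (IsCMField.complexConj L) v) (cmLocalForm L 3 v))) ∈ cmLocalIntegralLevel L 3 (Matrix.of fun i j : Fin 3 => if i.val + j.val + 1 = 3 then (1 : L) else 0) v → cmTorusCharPair L v χ₁ χ₂ t = 1) (ζ : ↥(normOneUnits (conjLocal L (IsCMField.complexConj L) v))) : χ₂ ζ = 1 := by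
  have h1 : (1 : (LocalRing L v)ˣ) ∈ (Submonoid.pi Set.univ (fun w : PlacesOver L v => (w.1.adicCompletionIntegers L).toSubring.toSubmonoid)).units := Subgroup.one_mem _
  have hK : ((F0P3cStCharTSTorusDefs.torusChart L v (1, ζ) : ↥(cmBorelTriple L 3 v).M) : ↥(unitaryGroupOfForm (conjLocal L (IsCMField.complexConj L) v) (cmLocalForm L 3 v))) ∈ cmLocalIntegralLevel L 3 (Matrix.of fun i j : Fin 3 => if i.val + j.val + 1 = 3 then (1 : L) else 0) v :=
    (F0P3cStCharTSTorusChartIso.torusChart_mem_cmLocalIntegralLevel_iff L v hns _).2 (Subgroup.mem_prod.2 ⟨h1, Subgroup.mem_top _⟩)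
  have h := hχK _ hK
  rwa [F0P3cStCharTSTorusDefs.cmTorusCharPair_torusChart, map_one, one_mul] at h

set_option synthInstance.maxHeartbeats 400000 in
set_option maxHeartbeats 3200000 in
-- the torus chart on the matrix carrier (class of ★ `K2E3SphericalCFunctionUnramifiedHypotheses.apply_eq_one_of_mem_unitsIntegers_of_trivial`)
include hns in
/-- **`wχ = (χ̄₁⁻¹, χ₂)` is unramified when `χ` is**: for `t = ι(α, ζ) ∈ T ∩ K_v` one has `α ∈ 𝒪_vˣ` (★ `torusChart_mem_cmLocalIntegralLevel_iff`), `χ̄₁⁻¹(α) = χ₁(σα)⁻¹ = χ₁(α)⁻¹ = 1`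
(★ `apply_unitsMap_conjLocal`, (H1) ★ `apply_eq_one_of_mem_unitsIntegers_of_trivial`) and `χ₂(ζ) = 1` (§1); every `t ∈ T` is some `ι(α, ζ)` (★ `torusChart` is onto: `torusChartHom`∕`exists_torusChart_eq`).
[cite: Rogawski1990, §12.2 p. 173] [cite: Keys1984, §7 p. 126] -/
theorem trivial_weyl_of_trivial (χ₁ : (LocalRing L v)ˣ →* ℂˣ) (χ₂ : ↥(normOneUnits (conjLocal L (IsCMField.complexConj L) v)) →* ℂˣ)
    (hχK : ∀ t : ↥(torusU (conjLocal L (IsCMField.complexConj L) v) (cmLocalForm L 3 v)), (t : ↥(unitaryGroupOfForm (conjLocal L (IsCMField.complexConj L) v) (cmLocalForm L 3 v))) ∈ cmLocalIntegralLevel L 3 (Matrix.of fun i j : Fin 3 => if i.val + j.val + 1 = 3 then (1 : L) else 0) v → cmTorusCharPair L v χ₁ χ₂ t = 1) :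
    ∀ t : ↥(torusU (conjLocal L (IsCMField.complexConj L) v) (cmLocalForm L 3 v)), (t : ↥(unitaryGroupOfForm (conjLocal L (IsCMField.complexConj L) v) (cmLocalForm L 3 v))) ∈ cmLocalIntegralLevel L 3 (Matrix.of fun i j : Fin 3 => if i.val + j.val + 1 = 3 then (1 : L) else 0) v → cmTorusCharPair L v (conjInvChar (conjLocal L (IsCMField.complexConj L) v) χ₁) χ₂ t = 1 := by
  have hunr := K2E3SphericalCFunctionUnramifiedHypotheses.apply_eq_one_of_mem_unitsIntegers_of_trivial L v hns χ₁ χ₂ hχK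
  intro t ht
  rw [← F0P3cStCharTSTorusChartIso.torusChart_torusCoords L v t] at ht ⊢
  have hm := (F0P3cStCharTSTorusChartIso.torusChart_mem_cmLocalIntegralLevel_iff L v hns _).1 ht
  rw [F0P3cStCharTSTorusDefs.cmTorusCharPair_torusChart, apply_normOneUnits_eq_one_of_trivial L v hns χ₁ χ₂ hχK, mul_one, conjInvChar_apply,
    K2E3SphericalCFunctionShellExpansion.apply_unitsMap_conjLocal L v hns χ₁ hunr, hunr _ (Subgroup.mem_prod.1 hm).1, inv_one]

/-! ## §2 The one-stop theorem -/

set_option synthInstance.maxHeartbeats 400000 in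
set_option maxHeartbeats 8000000 in
-- statement∕proof over two `SmoothInd` carriers of ★ `cmPrincipalSeries` (class of ★ `K2E3SphericalCFunctionMacdonald.exists_intertwiningIntegral_sphericalVector_eq_macdonald_smul`)
include hns in
/-- **HARISH-CHANDRA'S `c`-FUNCTION OF A `K_v`-SPHERICAL CONTRACTING `i_G(χ₁, χ₂)` AT AN INERT NON-DYADIC PLACE, organ currency.**  `v` non-split, UNRAMIFIED in `L`, `v ∤ 2` (`q_F = N𝔭_v`), `w₀` of
matrix `Φ₃`, `μ` a Haar measure of `N(L⁺_v)`, `ϖ` a uniformiser unit; `χ₁, χ₂` continuous with `χ = (χ₁, χ₂)` TRIVIAL ON `T ∩ K_v` and `χ₁` CONTRACTING (`‖x‖ < 1 ⇒ |χ₁ x| < 1`); `f_K ∈ i(χ)^{K_v}`,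
`f'_K ∈ i(wχ)^{K_v}` with `f'_K(1) = 1` (both EXIST: ★ `exists_sphericalVector` with `hχK`, resp. with §1 `trivial_weyl_of_trivial`).  Then the intertwining integral `J ≠ 0` (`(J f)(g) = ∫_N f(w₀ n g) dμ`)
satisfies **`J f_K = (μ(B₁)·(1 + z∕q_F)(1 − z∕q_F²)(1 − z²)⁻¹ · f_K(1)) • f'_K`**, `z = χ₁(ϖ)`, `B₁ = {‖u₀₂‖ ≤ 1} = N(𝒪_v)` — ★ p856288 (working hypotheses (H1)(H2)(H3) from the organ's) ∘ ★ p856339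
(Macdonald).  [cite: Rogawski1990, §4.5 p. 45; §12.2 p. 173] [cite: Casselman1995, §6.4 pp. 62–64] [cite: Keys1984, §4; §7 Thm (2)] [cite: CartierCorvallis1979, §IV.1] -/
theorem exists_intertwiningIntegral_sphericalVector_eq_macdonald_smul_of_trivial (w : PlacesOver L v)
    (hunrL : Algebra.IsUnramifiedIn (𝓞 L) v.asIdeal) (h2w : Valued.v (2 : w.1.adicCompletion L) = 1)
    (χ₁ : (LocalRing L v)ˣ →* ℂˣ) (χ₂ : ↥(normOneUnits (conjLocal L (IsCMField.complexConj L) v)) →* ℂˣ)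
    (h₁ : Continuous fun x => ((χ₁ x : ℂˣ) : ℂ)) (h₂ : Continuous fun x => ((χ₂ x : ℂˣ) : ℂ))
    (hχK : ∀ t : ↥(torusU (conjLocal L (IsCMField.complexConj L) v) (cmLocalForm L 3 v)), (t : ↥(unitaryGroupOfForm (conjLocal L (IsCMField.complexConj L) v) (cmLocalForm L 3 v))) ∈ cmLocalIntegralLevel L 3 (Matrix.of fun i j : Fin 3 => if i.val + j.val + 1 = 3 then (1 : L) else 0) v → cmTorusCharPair L v χ₁ χ₂ t = 1)
    (hcontr : ∀ x : (LocalRing L v)ˣ, unitModulusChar (LocalRing L v) x < 1 → ‖((χ₁ x : ℂˣ) : ℂ)‖ < 1)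
    (ϖ : (LocalRing L v)ˣ) (hϖ : ∀ w : PlacesOver L v, Valued.v ((ϖ : LocalRing L v) w) = WithZero.exp (-1 : ℤ))
    (w₀ : ↥(unitaryGroupOfForm (conjLocal L (IsCMField.complexConj L) v) (cmLocalForm L 3 v))) (hw₀ : Units.val (w₀ : GL (Fin 3) (LocalRing L v)) = cmLocalForm L 3 v)
    [MeasurableSpace ↥(cmBorelTriple L 3 v).N] [BorelSpace ↥(cmBorelTriple L 3 v).N] (μ : Measure ↥(cmBorelTriple L 3 v).N) [μ.IsHaarMeasure]
    (fK : haveI := locallyCompactSpace_cmBorelU L 3 v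
      Representation.SmoothInd (cmBorelTriple L 3 v).P (Representation.twist (((Representation.trivial ℂ ↥(torusU (conjLocal L (IsCMField.complexConj L) v) (cmLocalForm L 3 v)) ℂ).twist
        (cmTorusCharPair L v χ₁ χ₂)).comp (cmBorelTriple L 3 v).proj) (rootDeltaChar (cmBorelTriple L 3 v).P)))
    (hfK : haveI := locallyCompactSpace_cmBorelU L 3 v
      fK ∈ (Representation.smoothIndRep (cmBorelTriple L 3 v).P _).fixedPoints (cmLocalIntegralLevel L 3 (Matrix.of fun i j : Fin 3 => if i.val + j.val + 1 = 3 then (1 : L) else 0) v))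
    (fK' : haveI := locallyCompactSpace_cmBorelU L 3 v
      Representation.SmoothInd (cmBorelTriple L 3 v).P (Representation.twist (((Representation.trivial ℂ ↥(torusU (conjLocal L (IsCMField.complexConj L) v) (cmLocalForm L 3 v)) ℂ).twist
        (cmTorusCharPair L v (conjInvChar (conjLocal L (IsCMField.complexConj L) v) χ₁) χ₂)).comp (cmBorelTriple L 3 v).proj) (rootDeltaChar (cmBorelTriple L 3 v).P)))
    (hfK' : haveI := locallyCompactSpace_cmBorelU L 3 v
      fK' ∈ (Representation.smoothIndRep (cmBorelTriple L 3 v).P _).fixedPoints (cmLocalIntegralLevel L 3 (Matrix.of fun i j : Fin 3 => if i.val + j.val + 1 = 3 then (1 : L) else 0) v))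
    (hK'1 : fK'.toFun 1 = 1) :
    ∃ J : (cmPrincipalSeries L 3 v (cmTorusCharPair L v χ₁ χ₂)).IntertwiningMap (cmPrincipalSeries L 3 v (cmTorusCharPair L v (conjInvChar (conjLocal L (IsCMField.complexConj L) v) χ₁) χ₂)),
      J ≠ 0 ∧
      (∀ (f : haveI := locallyCompactSpace_cmBorelU L 3 v
      Representation.SmoothInd (cmBorelTriple L 3 v).P (Representation.twist (((Representation.trivial ℂ ↥(torusU (conjLocal L (IsCMField.complexConj L) v) (cmLocalForm L 3 v)) ℂ).twist
        (cmTorusCharPair L v χ₁ χ₂)).comp (cmBorelTriple L 3 v).proj) (rootDeltaChar (cmBorelTriple L 3 v).P)))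
        (g : ↥(unitaryGroupOfForm (conjLocal L (IsCMField.complexConj L) v) (cmLocalForm L 3 v))),
        (J f).toFun g = ∫ n : ↥(cmBorelTriple L 3 v).N, f.toFun (w₀ * (n : ↥(unitaryGroupOfForm (conjLocal L (IsCMField.complexConj L) v) (cmLocalForm L 3 v))) * g) ∂μ) ∧
      J fK = ((μ.real {u : ↥(cmBorelTriple L 3 v).N | (((∏ w' : PlacesOver L v, normAbs (w'.1.adicCompletion L) ((((((u : ↥(unitaryGroupOfForm (conjLocal L (IsCMField.complexConj L) v) (cmLocalForm L 3 v)))) : GL (Fin 3) (LocalRing L v)) : Matrix (Fin 3) (Fin 3) (LocalRing L v)) 0 2) w')) : ℝ≥0) : ℝ) ≤ 1} : ℂ) * ((1 + ((χ₁ ϖ : ℂˣ) : ℂ) / ((Ideal.absNorm v.asIdeal : ℕ) : ℂ)) * (1 - ((χ₁ ϖ : ℂˣ) : ℂ) / ((Ideal.absNorm v.asIdeal : ℕ) : ℂ) ^ 2) * (1 - ((χ₁ ϖ : ℂˣ) : ℂ) ^ 2)⁻¹) * fK.toFun 1) • fK' := by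
  have hunr := K2E3SphericalCFunctionUnramifiedHypotheses.apply_eq_one_of_mem_unitsIntegers_of_trivial L v hns χ₁ χ₂ hχK
  have hχ₂ := K2E3SphericalCFunctionUnramifiedHypotheses.apply_neg_one_eq_one_of_trivial L v hns χ₁ χ₂ hχK
  obtain ⟨s, hs, hχ₁⟩ := K2E3SphericalCFunctionUnramifiedHypotheses.exists_rpow_modulus_of_unramified_of_contracting L v hns χ₁ hunr hcontr
  exact K2E3SphericalCFunctionMacdonald.exists_intertwiningIntegral_sphericalVector_eq_macdonald_smul L v hns w hunrL h2w χ₁ χ₂ h₁ h₂ hχ₂ hunr hs hχ₁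
    ϖ hϖ w₀ hw₀ μ fK hfK fK' hfK' hK'1

end Summit.HodgeConjecture.HodgeConjecture.Cruxes.H413.K2E3SphericalCFunctionOrganCurrency

end
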